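import Summits.HodgeConjecture.HodgeConjecture.Theorems.Ring2WeilCoverageRelativeNormPositivity
import HarnessLib

/-!
# Weil-type family coverage — relative norms of units are totally positive at the two census levels:
# `L ⊇ ℚ(√13, √(78 − 18√13))` over `ℚ(√13)` (level `39`) and `L ⊇ ℚ(√2, √7)` over `ℚ(√2)` (level `56`)

research route conditional on HC_CM; not a corollary; Q11.4-sentence-2 already refuted in dim ≥ 3.

Ring 2, WEIL-TYPE FAMILY-COVERAGE CENSUS (`HOME/WEIL-FAMILY-COVERAGE.md` `## b01`, block b01.25 (A) «every unit of
`ℚ(ζ₃₉)⁺ / ℚ(ζ₅₆)⁺` has totally positive relative norm to `ℚ(√13) / ℚ(√2)` — PARI-certified»; owner ring2-b01), part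
34b of the `Ring2WeilCoverage*` series: the two INSTANCES of part 34 (`…RelativeNormPositivity.relNorm_coords`):

* **`re_embedding_relNorm_pos_thirteen`** (`d = 13`, `β = 78 − 18√13 = 3(26 − 6√13)`; `L ⊇` the real cyclic quartic
  field of conductor `39` inside `ℚ(ζ₃₉)⁺`): part 32 at the split primes `√13 ↦ ±4 (mod 3)` + part 32b ⇒ `U ≡ 2`,
  `V ≡ 0 (mod 3)`, `U > 0`, `U² − 13V² = 4` ⇒ **`Re σ(N_{L/ℚ(√13)}(x)) > 0` for every unit `x` and every embedding
  `σ`**;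
* **`re_embedding_relNorm_pos_two`** (`d = 2`, `β = 7`; `L ⊇ ℚ(√2, √7)`, e.g. `ℚ(ζ₅₆)⁺`): part 32 at `√2 ↦ ±3 (mod 7)`
  + part 32b ⇒ the same over `ℚ(√2)`.

In passing no unit of such an `L` has norm `−1` (THEOREM L (i) at `39`, new in the tree; at `56` it was part 8's
`√7` route).  NOTE on b01.38 (E)'s route note for `56`: the quartic field `ℚ(√2)(√(7(2 − √2)))` named there is
cyclic of conductor `112` and does NOT lie in `ℚ(ζ₅₆)⁺` (whose Galois group `C₂ × C₆` has no cyclic quartic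
quotient); the correct device at `56` is the biquadratic step `ℚ(√2, √7)/ℚ(√2)`, ramified at both primes above `7`,
used here.  HONEST FRAMING: statements about units of number fields containing the displayed elements; nothing
here mentions Hodge classes, polarisations, `W_K` or HC; `HC_CM` is used nowhere.  No `def`, no named fact, no
`sorry`.  Seat-derived [folklore].
-/

noncomputable section

open Module NumberField IntermediateField

namespace Summit.HodgeConjecture.Ring2WeilCoverage.RelativeNormPositivityLevels

open Summit.HodgeConjecture.Ring2WeilCoverage.QuarticNormObstruction (exists_coords norm_quadratic
  finrank_adjoin_eq_two)
open Summit.HodgeConjecture.Ring2WeilCoverage.SplitPrimeDescent (isSquare_lift_of_coords)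
open Summit.HodgeConjecture.Ring2WeilCoverage.SplitPrimePellSigns
open Summit.HodgeConjecture.Ring2WeilCoverage.RelativeNormPositivity

/-! ### The two census levels: `(d, β) = (13, 78 − 18√13)` and `(2, 7)` -/

/-- The split primes of `3` in `ℤ[√13]` (`√13 ↦ 4 ≡ 1`, `√13 ↦ −4 ≡ 2 (mod 3)`; `β/3 = 26 − 6√13`): the decidable
side conditions of part 32. [folklore] -/
theorem split_data_thirteen :
    ((1 : ZMod 3) * 1 = ((13 : ℤ) : ZMod 3) ∧ ((4 : ℤ) : ZMod 3) = 1 ∧ (2 * (4 : ℤ) : ZMod 3) ≠ 0 ∧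
        ((26 : ℤ) : ZMod 3) + ((-6 : ℤ) : ZMod 3) * 1 ≠ 0) ∧
      ((2 : ZMod 3) * 2 = ((13 : ℤ) : ZMod 3) ∧ ((-4 : ℤ) : ZMod 3) = 2 ∧ (2 * (-4 : ℤ) : ZMod 3) ≠ 0 ∧
        ((26 : ℤ) : ZMod 3) + ((-6 : ℤ) : ZMod 3) * 2 ≠ 0) := by
  decide

/-- The split primes of `7` in `ℤ[√2]` (`√2 ↦ 3`, `√2 ↦ −3 ≡ 4 (mod 7)`; `β/7 = 1`): the decidable side conditions
of part 32. [folklore] -/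
theorem split_data_two :
    ((3 : ZMod 7) * 3 = ((2 : ℤ) : ZMod 7) ∧ ((3 : ℤ) : ZMod 7) = 3 ∧ (2 * (3 : ℤ) : ZMod 7) ≠ 0 ∧
        ((1 : ℤ) : ZMod 7) + ((0 : ℤ) : ZMod 7) * 3 ≠ 0) ∧
      ((4 : ZMod 7) * 4 = ((2 : ℤ) : ZMod 7) ∧ ((-3 : ℤ) : ZMod 7) = 4 ∧ (2 * (-3 : ℤ) : ZMod 7) ≠ 0 ∧
        ((1 : ℤ) : ZMod 7) + ((0 : ℤ) : ZMod 7) * 4 ≠ 0) := by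
  decide

/-- `13` and `2` are squarefree and not rational squares. [folklore] -/
theorem squarefree_thirteen_and_two : Squarefree (13 : ℤ) ∧ Squarefree (2 : ℤ) ∧
    ¬ IsSquare ((13 : ℤ) : ℚ) ∧ ¬ IsSquare ((2 : ℤ) : ℚ) := by
  refine ⟨?_, ?_, ?_, ?_⟩
  · rw [show (13 : ℤ) = ((13 : ℕ) : ℤ) by norm_num, Int.squarefree_natCast]
    exact (by norm_num : Nat.Prime 13).squarefree
  · rw [show (2 : ℤ) = ((2 : ℕ) : ℤ) by norm_num, Int.squarefree_natCast]
    exact Nat.prime_two.squarefree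
  · have h : ¬ IsSquare (13 : ℕ) := by
      rintro ⟨r, hr⟩
      have hr2 : r ≤ 3 := by nlinarith
      interval_cases r <;> omega
    intro h'
    rw [show ((13 : ℤ) : ℚ) = ((13 : ℕ) : ℚ) by norm_num, Rat.isSquare_natCast_iff] at h'
    exact h h'
  · have h : ¬ IsSquare (2 : ℕ) := by
      rintro ⟨r, hr⟩
      have hr2 : r ≤ 1 := by nlinarith
      interval_cases r <;> omega
    intro h'
    rw [show ((2 : ℤ) : ℚ) = ((2 : ℕ) : ℚ) by norm_num, Rat.isSquare_natCast_iff] at h'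
    exact h h'

/-- **LEVEL `39`: every unit of a number field `L ∋ s, w`, `s² = 13`, `w² = 78 − 18s`, has TOTALLY POSITIVE relative
norm to `ℚ(s) = ℚ(√13)`**: `Re σ(N_{L/ℚ(s)}(x)) > 0` for every embedding `σ : L → ℂ`.  (`w ∉ ℚ(s)`:
`N(78 − 18s) = 1872 = 13·12²` is not a square.  `β = 3·(26 − 6s)`; part 32 at the split primes `√13 ↦ 4` and
`√13 ↦ −4` of `3` gives `2U + 2V ≡ □ ≢ 0` and `2U + 4V ≡ □ ≢ 0 (mod 3)`, part 32b gives `U ≡ 2`, `V ≡ 0`, then `U > 0`,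
`U² − 13V² = 4`.)  In `ℚ(ζ₃₉)⁺`: `s = 1 + 2(η + η³ + η⁴ + η⁹ + η¹⁰ + η¹²)` (`η = ζ₃₉³`), `w = 2(1 + 2ζ₃₉¹³)(π₀ − π₂)`.
research route conditional on HC_CM; not a corollary; Q11.4-sentence-2 already refuted in dim ≥ 3. [folklore] -/
theorem re_embedding_relNorm_pos_thirteen {L : Type*} [Field L] [NumberField L] {s w : L} (hs : s ^ 2 = 13)
    (hw : w ^ 2 = 78 - 18 * s) (x : (𝓞 L)ˣ) (σ : L →+* ℂ) :
    0 < (σ (algebraMap ℚ⟮s⟯ L (Algebra.norm ℚ⟮s⟯ ((x : 𝓞 L) : L)))).re := by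
  classical
  obtain ⟨hsf, -, hdsq, -⟩ := squarefree_thirteen_and_two
  have hs' : s ^ 2 = ((13 : ℤ) : L) := by rw [hs]; norm_num
  have hw' : w ^ 2 = ((78 : ℤ) : L) + ((-18 : ℤ) : L) * s := by rw [hw]; push_cast; ring
  -- `w ∉ ℚ(s)` via norms
  have hsℚ : s ∉ Set.range (algebraMap ℚ L) := by
    rintro ⟨r, hr⟩
    apply hdsq
    have h1 : algebraMap ℚ L (r ^ 2) = algebraMap ℚ L 13 := by rw [map_pow, hr, hs, map_ofNat]
    exact ⟨r, by rw [← sq]; exact_mod_cast ((algebraMap ℚ L).injective h1).symm⟩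
  have hint : IsIntegral ℚ s := Algebra.IsIntegral.isIntegral s
  have hss : s * s = algebraMap ℚ L 13 := by rw [← sq, hs, map_ofNat]
  have h2 : finrank ℚ ℚ⟮s⟯ = 2 := finrank_adjoin_eq_two hint hss hsℚ
  set s₁ : ℚ⟮s⟯ := AdjoinSimple.gen ℚ s with hs₁def
  have hs₁L : algebraMap ℚ⟮s⟯ L s₁ = s := AdjoinSimple.algebraMap_gen ℚ s
  have hs₁ : s₁ * s₁ = algebraMap ℚ ℚ⟮s⟯ 13 := by
    apply (algebraMap ℚ⟮s⟯ L).injective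
    rw [map_mul, hs₁L, ← IsScalarTower.algebraMap_apply ℚ ℚ⟮s⟯ L, hss]
  have hs₁ℚ : s₁ ∉ Set.range (algebraMap ℚ ℚ⟮s⟯) := by
    rintro ⟨r, hr⟩
    exact hsℚ ⟨r, by rw [IsScalarTower.algebraMap_apply ℚ ℚ⟮s⟯ L, hr, hs₁L]⟩
  have hws : w ∉ Set.range (algebraMap ℚ⟮s⟯ L) := by
    rintro ⟨z, hz⟩
    obtain ⟨x₁, x₂, hz'⟩ := exists_coords h2 hs₁ℚ z
    set β₁ : ℚ⟮s⟯ := algebraMap ℚ ℚ⟮s⟯ 78 + algebraMap ℚ ℚ⟮s⟯ (-18) * s₁ with hβ₁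
    have hzz : z * z = β₁ := by
      apply (algebraMap ℚ⟮s⟯ L).injective
      rw [map_mul, hz, hβ₁, map_add, map_mul, hs₁L, ← IsScalarTower.algebraMap_apply ℚ ℚ⟮s⟯ L,
        ← IsScalarTower.algebraMap_apply ℚ ℚ⟮s⟯ L, ← sq, hw]
      simp only [map_ofNat, map_neg]
      ring
    have hn1 : Algebra.norm ℚ z = x₁ ^ 2 - 13 * x₂ ^ 2 := by rw [hz']; exact norm_quadratic h2 hs₁ hs₁ℚ x₁ x₂
    have hn2 : Algebra.norm ℚ β₁ = 78 ^ 2 - 13 * (-18) ^ 2 := norm_quadratic h2 hs₁ hs₁ℚ _ _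
    have h3 : (x₁ ^ 2 - 13 * x₂ ^ 2) ^ 2 = 13 * 12 ^ 2 := by
      have e := congrArg (Algebra.norm ℚ) hzz
      rw [map_mul, hn1, hn2] at e
      linear_combination e
    apply hdsq
    refine ⟨(x₁ ^ 2 - 13 * x₂ ^ 2) / 12, ?_⟩
    push_cast
    linear_combination -h3 / 144
  obtain ⟨a₁, a₂, c₁, c₂, U, V, hU, hV, hpm, hy⟩ := relNorm_coords hsf hdsq hs' hw' hws x
  -- the two split primes of `3`
  have hUV : ¬ ((3 : ℕ) : ℤ) ∣ U ^ 2 - 13 * V ^ 2 := by rcases hpm with h | h <;> rw [h] <;> decide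
  have hU' : (U : ℚ) = 2 * (a₁ ^ 2 + (13 : ℤ) * a₂ ^ 2 - ((3 : ℕ) * (26 : ℤ)) * (c₁ ^ 2 + (13 : ℤ) * c₂ ^ 2) -
      (13 : ℤ) * ((3 : ℕ) * (-6 : ℤ)) * (2 * c₁ * c₂)) := by rw [hU]; push_cast; ring
  have hV' : (V : ℚ) = 2 * (2 * a₁ * a₂ - ((3 : ℕ) * (26 : ℤ)) * (2 * c₁ * c₂) -
      ((3 : ℕ) * (-6 : ℤ)) * (c₁ ^ 2 + (13 : ℤ) * c₂ ^ 2)) := by rw [hV]; push_cast; ring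
  haveI : Fact (Nat.Prime 3) := ⟨by norm_num⟩
  obtain ⟨⟨e1, f1, g1, k1⟩, ⟨e2, f2, g2, k2⟩⟩ := split_data_thirteen
  have h1 := isSquare_lift_of_coords (d := 13) (p := 3) ⟨1, e1⟩ (r₀ := 4) f1 (by norm_num)
    g1 (g₁ := 26) (g₂ := -6) k1 a₁ a₂ c₁ c₂ hU' hV' hUV
  have h2' := isSquare_lift_of_coords (d := 13) (p := 3) ⟨2, e2⟩ (r₀ := -4) f2 (by norm_num)
    g2 (g₁ := 26) (g₂ := -6) k2 a₁ a₂ c₁ c₂ hU' hV' hUV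
  obtain ⟨hU3, hV3⟩ := congr_thirteen h1 h2'
  obtain ⟨hUpos, hE⟩ := pos_of_pell_thirteen hpm hU3 hV3
  exact re_embedding_pos_of_coords (d := 13) (by norm_num) hs' hy hUpos (by rw [hE]; norm_num) σ

/-- **LEVEL `56`: every unit of a number field `L ∋ s, w`, `s² = 2`, `w² = 7`, has TOTALLY POSITIVE relative norm to
`ℚ(s) = ℚ(√2)`**: `Re σ(N_{L/ℚ(s)}(x)) > 0` for every embedding `σ`.  (`w ∉ ℚ(s)`: `x₁² + 2x₂² = 7`, `2x₁x₂ = 0` has no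
rational solution.  `β = 7 = 7·1`; part 32 at the split primes `√2 ↦ ±3` of `7` makes `2(U + 3V)`, `2(U + 4V)`
non-zero squares mod `7`, part 32b gives `U > 0`, `U² − 2V² = 4`.)  In `ℚ(ζ₅₆)⁺`: `s = ζ₈ + ζ₈⁻¹`,
`w = √7 ∈ ℚ(ζ₂₈)⁺` (part 9).
research route conditional on HC_CM; not a corollary; Q11.4-sentence-2 already refuted in dim ≥ 3. [folklore] -/
theorem re_embedding_relNorm_pos_two {L : Type*} [Field L] [NumberField L] {s w : L} (hs : s ^ 2 = 2)
    (hw : w ^ 2 = 7) (x : (𝓞 L)ˣ) (σ : L →+* ℂ) :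
    0 < (σ (algebraMap ℚ⟮s⟯ L (Algebra.norm ℚ⟮s⟯ ((x : 𝓞 L) : L)))).re := by
  classical
  obtain ⟨-, hsf, -, hdsq⟩ := squarefree_thirteen_and_two
  have hs' : s ^ 2 = ((2 : ℤ) : L) := by rw [hs]; norm_num
  have hw' : w ^ 2 = ((7 : ℤ) : L) + ((0 : ℤ) : L) * s := by rw [hw]; push_cast; ring
  have hsℚ : s ∉ Set.range (algebraMap ℚ L) := by
    rintro ⟨r, hr⟩
    apply hdsq
    have h1 : algebraMap ℚ L (r ^ 2) = algebraMap ℚ L 2 := by rw [map_pow, hr, hs, map_ofNat]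
    exact ⟨r, by rw [← sq]; exact_mod_cast ((algebraMap ℚ L).injective h1).symm⟩
  have hint : IsIntegral ℚ s := Algebra.IsIntegral.isIntegral s
  have hss : s * s = algebraMap ℚ L 2 := by rw [← sq, hs, map_ofNat]
  have h2 : finrank ℚ ℚ⟮s⟯ = 2 := finrank_adjoin_eq_two hint hss hsℚ
  set s₁ : ℚ⟮s⟯ := AdjoinSimple.gen ℚ s with hs₁def
  have hs₁L : algebraMap ℚ⟮s⟯ L s₁ = s := AdjoinSimple.algebraMap_gen ℚ s
  have hs₁ℚ : s₁ ∉ Set.range (algebraMap ℚ ℚ⟮s⟯) := by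
    rintro ⟨r, hr⟩
    exact hsℚ ⟨r, by rw [IsScalarTower.algebraMap_apply ℚ ℚ⟮s⟯ L, hr, hs₁L]⟩
  -- `w = √7 ∉ ℚ(√2)` by coordinates
  have hws : w ∉ Set.range (algebraMap ℚ⟮s⟯ L) := by
    rintro ⟨z, hz⟩
    obtain ⟨x₁, x₂, hz'⟩ := exists_coords h2 hs₁ℚ z
    have hzL : w = algebraMap ℚ L x₁ + algebraMap ℚ L x₂ * s := by
      rw [← hz, hz', map_add, map_mul, hs₁L, ← IsScalarTower.algebraMap_apply ℚ ℚ⟮s⟯ L,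
        ← IsScalarTower.algebraMap_apply ℚ ℚ⟮s⟯ L]
    have hsq : algebraMap ℚ L (x₁ ^ 2 + 2 * x₂ ^ 2) + algebraMap ℚ L (2 * x₁ * x₂) * s =
        algebraMap ℚ L 7 + algebraMap ℚ L 0 * s := by
      have e : w ^ 2 = 7 := hw
      rw [hzL] at e
      simp only [map_add, map_mul, map_pow, map_ofNat, map_zero]
      linear_combination e - (algebraMap ℚ L x₂) ^ 2 * hs
    obtain ⟨hA, hB⟩ := coords_unique hsℚ hsq
    have h7 : ¬ IsSquare (7 : ℚ) := by
      have h : ¬ IsSquare (7 : ℕ) := by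
        rintro ⟨r, hr⟩
        have hr2 : r ≤ 2 := by nlinarith
        interval_cases r <;> omega
      intro h'
      rw [show (7 : ℚ) = ((7 : ℕ) : ℚ) by norm_num, Rat.isSquare_natCast_iff] at h'
      exact h h'
    have h14 : ¬ IsSquare (14 : ℚ) := by
      have h : ¬ IsSquare (14 : ℕ) := by
        rintro ⟨r, hr⟩
        have hr2 : r ≤ 3 := by nlinarith
        interval_cases r <;> omega
      intro h'
      rw [show (14 : ℚ) = ((14 : ℕ) : ℚ) by norm_num, Rat.isSquare_natCast_iff] at h'
      exact h h'
    rcases mul_eq_zero.mp (show (2 * x₁) * x₂ = 0 by linear_combination hB) with h0 | h0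
    · have hx₁ : x₁ = 0 := by linarith
      rw [hx₁] at hA
      exact h14 ⟨2 * x₂, by linear_combination -2 * hA⟩
    · rw [h0] at hA
      exact h7 ⟨x₁, by linear_combination -hA⟩
  obtain ⟨a₁, a₂, c₁, c₂, U, V, hU, hV, hpm, hy⟩ := relNorm_coords hsf hdsq hs' hw' hws x
  have hUV : ¬ ((7 : ℕ) : ℤ) ∣ U ^ 2 - 2 * V ^ 2 := by rcases hpm with h | h <;> rw [h] <;> decide
  have hU' : (U : ℚ) = 2 * (a₁ ^ 2 + (2 : ℤ) * a₂ ^ 2 - ((7 : ℕ) * (1 : ℤ)) * (c₁ ^ 2 + (2 : ℤ) * c₂ ^ 2) -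
      (2 : ℤ) * ((7 : ℕ) * (0 : ℤ)) * (2 * c₁ * c₂)) := by rw [hU]; push_cast; ring
  have hV' : (V : ℚ) = 2 * (2 * a₁ * a₂ - ((7 : ℕ) * (1 : ℤ)) * (2 * c₁ * c₂) -
      ((7 : ℕ) * (0 : ℤ)) * (c₁ ^ 2 + (2 : ℤ) * c₂ ^ 2)) := by rw [hV]; push_cast; ring
  haveI : Fact (Nat.Prime 7) := ⟨by norm_num⟩
  obtain ⟨⟨e1, f1, g1, k1⟩, ⟨e2, f2, g2, k2⟩⟩ := split_data_two
  have h1 := isSquare_lift_of_coords (d := 2) (p := 7) ⟨3, e1⟩ (r₀ := 3) f1 (by norm_num)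
    g1 (g₁ := 1) (g₂ := 0) k1 a₁ a₂ c₁ c₂ hU' hV' hUV
  have h2' := isSquare_lift_of_coords (d := 2) (p := 7) ⟨4, e2⟩ (r₀ := -3) f2 (by norm_num)
    g2 (g₁ := 1) (g₂ := 0) k2 a₁ a₂ c₁ c₂ hU' hV' hUV
  obtain ⟨hUpos, hE⟩ := pos_of_pell_two hpm h1 h2'
  exact re_embedding_pos_of_coords (d := 2) (by norm_num) hs' hy hUpos (by rw [hE]; norm_num) σ

end Summit.HodgeConjecture.Ring2WeilCoverage.RelativeNormPositivityLevels

end
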